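import Summits.CriticalPhenomena.PercolationContinuityZ3.Theorems.Transplant.WeightedConeMove
import HarnessLib

/-!
# WEIGHTED CONES of `ℤ³` — V: the GREEDY SCHEDULE of raise-the-minimal-ratio moves up to the lattice station `⌈R v⌉`
# (third file of the uniqueness column for `𝕂_{v,τ,h} = {h ≤ ⟨v,x⟩, vⱼxᵢ − vᵢxⱼ ≤ τ⟨v,x⟩}`)

builds on p205010 (kernel theorem, internal audit signed; external expert review pending) — NOT used in this file.
Lane `prim-bschramm`, seat `prim-bschramm-p2` (gen 30; class C1b = sub-domains of `ℤ³` at their own critical point, METHOD = input substitution;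
memo `HOME/bschramm/P2-LATTICES.md` §106); helper file (`--supports stmt-CriticalPhenomena-4575 --as helper`) for ROW N6 of TABLE v44.
Gen 29's `DiagonalConeSchedule` WITH WEIGHTS and with ONE potential instead of two phases.

THE SCHEDULE.  At level `N` with move cap `A` and target `Ω = ⌈Rv⌉` (`(A + k)K ≤ τN`, `K(A + ⌊A/m⌋) ≤ τN`), a point `P` is INVARIANT (`Inv`) if
`P ∈ 𝕂`, every pair inequality has slack `kK`, `H(P) > N` and `Pⱼ ≤ ⌈Rvⱼ⌉` for all `j`.  While `P ≠ Ω`: among the OPEN coordinates (`Pⱼ < ⌈Rvⱼ⌉`)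
take `lo` of minimal ratio `Pⱼ/vⱼ` — then `D_{lo,j}(P) ≤ 0` for EVERY `j` (for a closed `j`: `P_lo < Rv_lo` and `Pⱼ = ⌈Rvⱼ⌉ ≥ Rvⱼ`), and the other
two coordinates sort (`exists_frame`) — and raise `P_lo` by `a = min(A, ⌈Rv_lo⌉ − P_lo)` (`WeightedConeMove.raise_datum`, probability `α₂α`, `k` edges);
the invariant is kept (`inv_move`: the new terms `D_{lo,j} ≤ aK ≤ AK` are paid by `τH ≥ τN`).  The POTENTIAL
`Ψ(P) = Σⱼ [(⌈Rvⱼ⌉ − Pⱼ) + A·𝟙(Pⱼ < ⌈Rvⱼ⌉)]` drops by `≥ A` at every move (a full move lowers a gap by `A`; a closing move kills a gap `≥ 1` and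
its indicator `A`), and `Ψ < A` forces `P = Ω`; so **`schedule`**: `Ψ(P) < (n+1)A` ⇒ `n` moves reach `Ω` (probability `(α₂α)ⁿ`, `n·k` edges).
§1 the invariant, the frame of an invariant point, one move; §2 the potential and the schedule.
[cite: AizenmanChayesChayesFrohlichRusso1983, §4 Cor. to Lemma 4.3, Lemma 4.2 (a)] [cite: GrimmettPercolation1999, Thm. (2.4)] -/

noncomputable section

namespace Summit.CriticalPhenomena.PercolationContinuityZ3.Theorems.Transplant

namespace WCone

open MeasureTheory Literature.Probability.Percolation Literature.Probability.LatticeModels SimpleGraph HSU OrthantUniq HalfSlabUniq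
  TubeSlabUniq DesignTransport WallUniq DiagCone SectorSlab ConeSlabUniq Filter
open scoped Classical

/-! ## §1 The invariant, the frame of an invariant point, one move -/

/-- **The schedule invariant** at level `N` with target `⌈Rv⌉`: `P ∈ 𝕂`, slack `kK`, height `> N`, coordinates `≤ ⌈Rvⱼ⌉`. [folklore] -/
def Inv (D : Set (Site 3)) (v : Fin 3 → ℝ) (τ K : ℝ) (k N : ℕ) (R : ℝ) (P : Site 3) : Prop :=
  P ∈ D ∧ (∀ i j : Fin 3, dev v P i j + k * K ≤ τ * hgt v P) ∧ (N : ℝ) < hgt v P ∧ ∀ j, P j ≤ tgt v R j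

/-- The six coordinate frames of `ℤ³` (values of `π 1, π 2, π 0`). [folklore] -/
theorem perm_table :
    ((Equiv.swap (1 : Fin 3) 2 * Equiv.swap 0 1 : Equiv.Perm (Fin 3)) 1 = 0 ∧
      (Equiv.swap (1 : Fin 3) 2 * Equiv.swap 0 1 : Equiv.Perm (Fin 3)) 2 = 1 ∧
      (Equiv.swap (1 : Fin 3) 2 * Equiv.swap 0 1 : Equiv.Perm (Fin 3)) 0 = 2) ∧
    ((Equiv.swap (0 : Fin 3) 1) 1 = 0 ∧ (Equiv.swap (0 : Fin 3) 1) 2 = 2 ∧ (Equiv.swap (0 : Fin 3) 1) 0 = 1) ∧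
    ((Equiv.swap (0 : Fin 3) 2) 1 = 1 ∧ (Equiv.swap (0 : Fin 3) 2) 2 = 0 ∧ (Equiv.swap (0 : Fin 3) 2) 0 = 2) ∧
    ((Equiv.swap (0 : Fin 3) 1 * Equiv.swap 1 2 : Equiv.Perm (Fin 3)) 1 = 2 ∧
      (Equiv.swap (0 : Fin 3) 1 * Equiv.swap 1 2 : Equiv.Perm (Fin 3)) 2 = 0 ∧
      (Equiv.swap (0 : Fin 3) 1 * Equiv.swap 1 2 : Equiv.Perm (Fin 3)) 0 = 1) ∧
    ((Equiv.swap (1 : Fin 3) 2) 1 = 2 ∧ (Equiv.swap (1 : Fin 3) 2) 2 = 1 ∧ (Equiv.swap (1 : Fin 3) 2) 0 = 0) := by decide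

section Cone

variable {v : Fin 3 → ℝ} {κ K τ h : ℝ} (hκ : 0 < κ) (hvκ : ∀ i, κ ≤ v i) (hvK : ∀ i, v i ≤ K) (hτ : 0 < τ) (hh : K ≤ τ * h)
  {D : Set (Site 3)} (hCD : ∀ x : Site 3, x ∈ D ↔ h ≤ hgt v x ∧ ∀ i j : Fin 3, dev v x i j ≤ τ * hgt v x)
  {k : ℕ}

include hκ hvκ in
/-- **An open coordinate of minimal ratio is minimal against EVERY coordinate.**  If `Pⱼ ≤ ⌈Rvⱼ⌉` for all `j`, `Pᵢ < ⌈Rvᵢ⌉`, and `Pᵢ/vᵢ ≤ Pⱼ/vⱼ`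
for every open `j` (`Pⱼ < ⌈Rvⱼ⌉`), then `D_{ij}(P) ≤ 0` for all `j` (closed `j`: `Pᵢ ≤ ⌈Rvᵢ⌉ − 1 < Rvᵢ`, `Pⱼ = ⌈Rvⱼ⌉ ≥ Rvⱼ`). [folklore] -/
theorem low_of_open_min {P : Site 3} {R : ℝ} (hle : ∀ j, P j ≤ tgt v R j) {i : Fin 3} (hi : P i < tgt v R i)
    (hmin : ∀ j, P j < tgt v R j → (P i : ℝ) / v i ≤ (P j : ℝ) / v j) : ∀ j, dev v P i j ≤ 0 := by
  intro j
  have hvi := v_pos hκ hvκ i; have hvj := v_pos hκ hvκ j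
  unfold dev
  by_cases hj : P j < tgt v R j
  · have h1 := hmin j hj
    rw [div_le_div_iff₀ hvi hvj] at h1
    linarith
  · have hPj : P j = ⌈R * v j⌉ := by have := hle j; rw [tgt_apply] at this hj; omega
    have hPi : P i ≤ ⌈R * v i⌉ - 1 := by have := hi; rw [tgt_apply] at this; omega
    have r1 : (P i : ℝ) < R * v i := by
      have h1 : ((P i : ℤ) : ℝ) ≤ ((⌈R * v i⌉ - 1 : ℤ) : ℝ) := by exact_mod_cast hPi
      have h2 : ((⌈R * v i⌉ : ℤ) : ℝ) < R * v i + 1 := Int.ceil_lt_add_one _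
      push_cast at h1; linarith
    have r2 : R * v j ≤ (P j : ℝ) := by rw [hPj]; exact Int.le_ceil _
    nlinarith [mul_lt_mul_of_pos_left r1 hvj, mul_le_mul_of_nonneg_left r2 hvi.le]

include hκ hvκ in
/-- **The frame of a point below its target.**  If `Pⱼ ≤ ⌈Rvⱼ⌉` for all `j` and `P ≠ ⌈Rv⌉`, there is a coordinate frame `π` with `P_{π1} < ⌈Rv_{π1}⌉`
(open), `D_{π1,j}(P) ≤ 0` for all `j` (minimal ratio among the open coordinates), and `D_{π2,π0}(P) ≤ 0` (the other two sorted). [folklore] -/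
theorem exists_frame {P : Site 3} {R : ℝ} (hle : ∀ j, P j ≤ tgt v R j) (hne : P ≠ tgt v R) :
    ∃ π : Equiv.Perm (Fin 3), (∀ j, dev v P (π 1) j ≤ 0) ∧ dev v P (π 2) (π 0) ≤ 0 ∧ P (π 1) < tgt v R (π 1) := by
  obtain ⟨vA, vB, vC, vE, vF⟩ := perm_table
  -- the open coordinates and one of minimal ratio among them
  set O : Finset (Fin 3) := Finset.univ.filter fun j => P j < tgt v R j with hO
  have hOne : O.Nonempty := by
    by_contra hemp
    rw [Finset.not_nonempty_iff_eq_empty] at hemp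
    apply hne
    funext j
    have hj : ¬ P j < tgt v R j := fun hlt => by
      have : j ∈ O := Finset.mem_filter.2 ⟨Finset.mem_univ _, hlt⟩
      rw [hemp] at this; simp at this
    exact le_antisymm (hle j) (not_lt.1 hj)
  obtain ⟨i, hiO, hmin⟩ := O.exists_min_image (fun j => (P j : ℝ) / v j) hOne
  have hi : P i < tgt v R i := (Finset.mem_filter.1 hiO).2
  have hlow : ∀ j, dev v P i j ≤ 0 :=
    low_of_open_min hκ hvκ hle hi fun j hj => hmin j (Finset.mem_filter.2 ⟨Finset.mem_univ _, hj⟩)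
  -- sort the other two coordinates
  have hsort : ∀ a b : Fin 3, dev v P a b ≤ 0 ∨ dev v P b a ≤ 0 := fun a b => by
    rw [dev_swap v P a b]
    rcases le_total (dev v P a b) 0 with h | h
    · exact Or.inl h
    · exact Or.inr (by linarith)
  fin_cases i
  · rcases hsort 1 2 with h12 | h21
    · exact ⟨Equiv.swap 1 2 * Equiv.swap 0 1, by rw [vA.1]; exact hlow, by rw [vA.2.1, vA.2.2]; exact h12, by rw [vA.1]; exact hi⟩
    · exact ⟨Equiv.swap 0 1, by rw [vB.1]; exact hlow, by rw [vB.2.1, vB.2.2]; exact h21, by rw [vB.1]; exact hi⟩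
  · rcases hsort 0 2 with h02 | h20
    · exact ⟨Equiv.swap 0 2, by rw [vC.1]; exact hlow, by rw [vC.2.1, vC.2.2]; exact h02, by rw [vC.1]; exact hi⟩
    · exact ⟨1, hlow, h20, hi⟩
  · rcases hsort 0 1 with h01 | h10
    · exact ⟨Equiv.swap 0 1 * Equiv.swap 1 2, by rw [vE.1]; exact hlow, by rw [vE.2.1, vE.2.2]; exact h01, by rw [vE.1]; exact hi⟩
    · exact ⟨Equiv.swap 1 2, by rw [vF.1]; exact hlow, by rw [vF.2.1, vF.2.2]; exact h10, by rw [vF.1]; exact hi⟩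

/-- Coordinates after raising `P_l` by `a`. [folklore] -/
theorem raise_apply (P : Site 3) (l : Fin 3) (a : ℤ) (j : Fin 3) :
    (P + a • (Pi.single l 1 : Site 3)) j = P j + if j = l then a else 0 := by
  simp [Pi.single_apply]

/-- Height and deviations after raising `P_l` by `a`: `H ↦ H + a v_l`, `D_{ij} ↦ D_{ij} + [i = l] a vⱼ − [j = l] a vᵢ`. [folklore] -/
theorem raise_hgt_dev (v : Fin 3 → ℝ) (P : Site 3) (l : Fin 3) (a : ℤ) :
    hgt v (P + a • (Pi.single l 1 : Site 3)) = hgt v P + (a : ℝ) * v l ∧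
      ∀ i j, dev v (P + a • (Pi.single l 1 : Site 3)) i j =
        dev v P i j + (if i = l then (a : ℝ) * v j else 0) - (if j = l then (a : ℝ) * v i else 0) := by
  have e : ∀ j, (((P + a • (Pi.single l 1 : Site 3)) j : ℤ) : ℝ) = (P j : ℝ) + if j = l then (a : ℝ) else 0 := fun j => by
    rw [raise_apply]; push_cast; split_ifs <;> simp
  refine ⟨?_, fun i j => ?_⟩
  · simp only [hgt, e]; fin_cases l <;> simp <;> ring
  · simp only [dev, e]; split_ifs <;> ring

include hκ hvκ hvK hτ in
/-- **One move preserves the invariant**: raising the minimal-ratio coordinate `P_{π1}` (`D_{π1,j}(P) ≤ 0 ∀ j`) by `a ≤ A` with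
`P_{π1} + a ≤ ⌈Rv_{π1}⌉`, when `(A + k)K ≤ τN` and the new point lies in `𝕂` (the new terms `D_{π1,j} ≤ a vⱼ ≤ AK` are paid by `τH > τN`; the
others only improve). [folklore] -/
theorem inv_move {N : ℕ} {R : ℝ} {Acap : ℕ} (hcap : ((Acap : ℝ) + k) * K ≤ τ * N) {P : Site 3} (hI : Inv D v τ K k N R P)
    (π : Equiv.Perm (Fin 3)) (hlo : ∀ j, dev v P (π 1) j ≤ 0) {a : ℕ} (haA : a ≤ Acap) (haM : P (π 1) + a ≤ tgt v R (π 1))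
    (hmemD : P + (a : ℤ) • (Pi.single (π 1) 1 : Site 3) ∈ D) : Inv D v τ K k N R (P + (a : ℤ) • (Pi.single (π 1) 1 : Site 3)) := by
  obtain ⟨-, hslack, hN, hM⟩ := hI
  obtain ⟨hH, hdev⟩ := raise_hgt_dev v P (π 1) (a : ℤ)
  push_cast at hH hdev
  have hvl := v_pos hκ hvκ (π 1)
  have ha0 : (0 : ℝ) ≤ a := by positivity
  have haA' : (a : ℝ) ≤ Acap := by exact_mod_cast haA
  have hav : 0 ≤ (a : ℝ) * v (π 1) := mul_nonneg ha0 hvl.le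
  have hK0 : 0 ≤ K := hvl.le.trans (hvK _)
  refine ⟨hmemD, fun i j => ?_, by rw [hH]; linarith, fun j => ?_⟩
  · rw [hH, hdev i j]
    have hs := hslack i j
    have hτN : τ * (N : ℝ) ≤ τ * hgt v P := mul_le_mul_of_nonneg_left hN.le hτ.le
    have hτa : 0 ≤ τ * ((a : ℝ) * v (π 1)) := mul_nonneg hτ.le hav
    by_cases hi : i = π 1
    · by_cases hj : j = π 1
      · rw [if_pos hi, if_pos hj, hi, hj, dev_self]
        have h0 := hslack (π 1) (π 1); rw [dev_self] at h0; linarith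
      · rw [if_pos hi, if_neg hj, hi]
        have h1 := hlo j
        have h2 : (a : ℝ) * v j ≤ Acap * K := mul_le_mul haA' (hvK j) (v_pos hκ hvκ j).le (by positivity)
        linarith
    · rw [if_neg hi]
      by_cases hj : j = π 1
      · rw [if_pos hj]; have : 0 ≤ (a : ℝ) * v i := mul_nonneg ha0 (v_pos hκ hvκ i).le; linarith
      · rw [if_neg hj]; linarith
  · rw [raise_apply]
    by_cases hj : j = π 1
    · rw [if_pos hj, hj]; exact haM
    · rw [if_neg hj, add_zero]; exact hM j

/-- The window constant of the invariant points: `Q_R = ⌈C · 3K(RK + 1)⌉` (height `≤ Σ vⱼ⌈Rvⱼ⌉ ≤ 3K(RK+1)`, `C = bnd v τ K`). [folklore] -/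
def winQ (v : Fin 3 → ℝ) (τ K R : ℝ) : ℕ := ⌈bnd v τ K * (3 * K * (R * K + 1))⌉₊

include hκ hvκ hvK hτ hh hCD in
/-- Coordinates of an invariant point are bounded by `Q_R` (`R ≥ 0`). [folklore] -/
theorem abs_le_of_inv {N : ℕ} {R : ℝ} (hR0 : 0 ≤ R) {P : Site 3} (hI : Inv D v τ K k N R P) : ∀ j, |P j| ≤ (winQ v τ K R : ℤ) := by
  obtain ⟨hP, -, -, hM⟩ := hI
  have hK : 0 < K := (v_pos hκ hvκ 0).trans_le (hvK 0)
  have hRK : 0 ≤ R * K + 1 := by positivity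
  have hc : ∀ j, (P j : ℝ) ≤ R * K + 1 := fun j => by
    have h1 : ((P j : ℤ) : ℝ) ≤ ((⌈R * v j⌉ : ℤ) : ℝ) := by exact_mod_cast hM j
    have h2 : ((⌈R * v j⌉ : ℤ) : ℝ) < R * v j + 1 := Int.ceil_lt_add_one _
    have h3 : R * v j ≤ R * K := mul_le_mul_of_nonneg_left (hvK j) hR0
    linarith
  have hS : hgt v P ≤ 3 * K * (R * K + 1) := by
    have e : ∀ j, v j * (P j : ℝ) ≤ K * (R * K + 1) := fun j =>
      (mul_le_mul_of_nonneg_left (hc j) (v_pos hκ hvκ j).le).trans (mul_le_mul_of_nonneg_right (hvK j) hRK)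
    unfold hgt; linarith [e 0, e 1, e 2]
  intro j
  have h1 := abs_le_of_mem hκ hvκ hvK hτ hh hCD hP hS j
  have h2 : bnd v τ K * (3 * K * (R * K + 1)) ≤ (winQ v τ K R : ℝ) := Nat.le_ceil _
  have h3 : ((|P j| : ℤ) : ℝ) ≤ (((winQ v τ K R : ℕ) : ℤ) : ℝ) := by push_cast; linarith
  exact_mod_cast h3

/-- `a + ⌊a/m⌋` is monotone in `a`. [folklore] -/
theorem Tmv_mono {m a b : ℕ} (h : a ≤ b) : a + a / m ≤ b + b / m := Nat.add_le_add h (Nat.div_le_div_right h)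

include hκ hvκ hvK hτ hh hCD in
/-- **The move datum under the invariant**: for `P` invariant with frame `π` (minimal ratio at `π1`, `D_{π2,π0}(P) ≤ 0`), `a ≤ A` with
`P_{π1} + a ≤ ⌈Rv_{π1}⌉`, caps `(A + k)K ≤ τN` and `K(A + ⌊A/m⌋) ≤ τN`: a datum `P → P + a e_{π1}` of probability `α₂α`, `k` extra edges, in any
window `≥ A + ⌊A/m⌋ + k + Q_R`; and the new point is invariant. [cite: AizenmanChayesChayesFrohlichRusso1983, §4 Lemma 4.3] -/
theorem move_step {N : ℕ} {Λ : Set (Site 3)} (hΛ : ∀ x ∈ Λ, hgt v x ≤ (N : ℝ)) {p' : unitInterval} (A : SlabArmKit k p')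
    {m : ℕ} (hm : 1 ≤ m) (hmK : K ≤ (m : ℝ) * κ) {α₂ : ℝ} (hα₂ : 0 < α₂)
    (harm : ∀ b : Site 3, b ∈ slab 3 k →
      α₂ ≤ (bondPercolation (zdGraph 3) p').real (percolatesVia (withinGraph (zdGraph 3) (steepSetM (2 * m) k 1 b)) b))
    {R : ℝ} (hR0 : 0 ≤ R) {Acap Mw : ℕ} (hcapS : ((Acap : ℝ) + k) * K ≤ τ * N) (hcapT : K * ((Acap + Acap / m : ℕ) : ℝ) ≤ τ * N)
    (hMw : Acap + Acap / m + k + winQ v τ K R ≤ Mw) {P : Site 3} (hI : Inv D v τ K k N R P) (π : Equiv.Perm (Fin 3))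
    (hlo : ∀ j, dev v P (π 1) j ≤ 0) (hmh : dev v P (π 2) (π 0) ≤ 0) {a : ℕ} (haA : a ≤ Acap) (haM : P (π 1) + a ≤ tgt v R (π 1)) :
    Datum D Λ p' Mw (α₂ * A.α) k P (P + (a : ℤ) • (Pi.single (π 1) 1 : Site 3)) ∧
      Inv D v τ K k N R (P + (a : ℤ) • (Pi.single (π 1) 1 : Site 3)) := by
  obtain ⟨hP, hslack, hN, hM⟩ := hI
  have hK : 0 < K := (v_pos hκ hvκ 0).trans_le (hvK 0)
  have hτN : τ * (N : ℝ) ≤ τ * hgt v P := mul_le_mul_of_nonneg_left hN.le hτ.le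
  have haT : K * ((a + a / m : ℕ) : ℝ) ≤ τ * hgt v P := by
    have h1 : ((a + a / m : ℕ) : ℝ) ≤ ((Acap + Acap / m : ℕ) : ℝ) := by exact_mod_cast Tmv_mono haA
    have h2 := mul_le_mul_of_nonneg_left h1 hK.le
    linarith
  have hd := raise_datum hκ hvκ hvK hτ hCD hΛ A hm hmK hα₂ harm π hP hlo hmh hslack hN haT (abs_le_of_inv hκ hvκ hvK hτ hh hCD hR0 ⟨hP, hslack, hN, hM⟩)
  have hd' : Datum D Λ p' Mw (α₂ * A.α) k P (P + (a : ℤ) • (Pi.single (π 1) 1 : Site 3)) :=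
    datum_weaken le_rfl le_rfl ((Nat.add_le_add_right (Nat.add_le_add_right (Tmv_mono haA) _) _).trans hMw) hd
  refine ⟨hd', inv_move hκ hvκ hvK hτ hcapS ⟨hP, hslack, hN, hM⟩ π hlo haA haM ?_⟩
  -- the port `(0, a, 0)` of the frame lies in `𝕂`
  have hTa : (a : ℤ) ≤ ((a + a / m : ℕ) : ℤ) := by exact_mod_cast Nat.le_add_right a (a / m)
  have hT0 : (0 : ℤ) ≤ ((a + a / m : ℕ) : ℤ) := by positivity
  have e1 : (![0, (a : ℤ), 0] : Site 3) 1 = a := rfl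
  have e2 : (![0, (a : ℤ), 0] : Site 3) 2 = 0 := rfl
  have hmem := (frame_mem hκ hvκ hvK hτ hCD π hP hlo hmh hslack haT (y := ![0, (a : ℤ), 0]) (by simp)
    (by rw [e1]; exact ⟨by positivity, hTa⟩) (by rw [e2]; exact ⟨le_rfl, hT0⟩)
    (by rw [e1, e2]; push_cast; rw [mul_zero]; exact mul_nonneg (v_pos hκ hvκ (π 2)).le (by positivity))).1
  rwa [frame_port] at hmem

/-! ## §2 The potential and the schedule -/

/-- The potential of one coordinate: gap plus `A` if the coordinate is open. [folklore] -/
def gapA (A : ℕ) (T P : ℤ) : ℤ := (T - P) + if P < T then (A : ℤ) else 0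

/-- **The schedule potential** `Ψ(P) = Σⱼ [(⌈Rvⱼ⌉ − Pⱼ) + A·𝟙(Pⱼ < ⌈Rvⱼ⌉)]`. [folklore] -/
def pot (v : Fin 3 → ℝ) (R : ℝ) (A : ℕ) (P : Site 3) : ℤ :=
  gapA A (tgt v R 0) (P 0) + gapA A (tgt v R 1) (P 1) + gapA A (tgt v R 2) (P 2)

/-- A coordinate potential is `≥ 0` below the target, and `< A` only at the target. [folklore] -/
theorem gapA_props (A : ℕ) {T P : ℤ} (h : P ≤ T) : 0 ≤ gapA A T P ∧ (gapA A T P < A → P = T) := by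
  unfold gapA
  by_cases hlt : P < T
  · rw [if_pos hlt]; exact ⟨by omega, fun _ => by omega⟩
  · rw [if_neg hlt]; exact ⟨by omega, fun _ => by omega⟩

/-- **A move lowers the coordinate potential by `≥ A`**: full move (`a = A`) or closing move (`P + a = T`, `a ≥ 1`). [folklore] -/
theorem gapA_move (A : ℕ) {T P : ℤ} {a : ℕ} (ha1 : 1 ≤ a) (haT : P + a ≤ T) (ha : a = A ∨ P + a = T) :
    gapA A T (P + a) + A ≤ gapA A T P := by
  unfold gapA
  rw [if_pos (show P < T by omega)]
  rcases ha with rfl | h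
  · by_cases hlt : P + (a : ℤ) < T
    · rw [if_pos hlt]; omega
    · rw [if_neg hlt]; omega
  · rw [if_neg (show ¬ (P + (a : ℤ) < T) by omega)]; omega

include hκ hvκ hvK hτ hh hCD in
/-- **THE SCHEDULE.**  With the caps of `move_step` and `A ≥ 1`: if `P` is invariant with potential `Ψ(P) < (n+1)A`, then `n` moves reach the
station `⌈Rv⌉`: probability `(α₂α)ⁿ`, `n·k` extra edges (each move lowers `Ψ` by `≥ A`; `Ψ < A` forces `P = ⌈Rv⌉`).
[cite: AizenmanChayesChayesFrohlichRusso1983, §4 Cor. to Lemma 4.3] -/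
theorem schedule {N : ℕ} {Λ : Set (Site 3)} (hΛ : ∀ x ∈ Λ, hgt v x ≤ (N : ℝ)) {p' : unitInterval} (A : SlabArmKit k p')
    {m : ℕ} (hm : 1 ≤ m) (hmK : K ≤ (m : ℝ) * κ) {α₂ : ℝ} (hα₂ : 0 < α₂)
    (harm : ∀ b : Site 3, b ∈ slab 3 k →
      α₂ ≤ (bondPercolation (zdGraph 3) p').real (percolatesVia (withinGraph (zdGraph 3) (steepSetM (2 * m) k 1 b)) b))
    {R : ℝ} (hR0 : 0 ≤ R) {Acap Mw : ℕ} (hA1 : 1 ≤ Acap) (hcapS : ((Acap : ℝ) + k) * K ≤ τ * N)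
    (hcapT : K * ((Acap + Acap / m : ℕ) : ℝ) ≤ τ * N) (hMw : Acap + Acap / m + k + winQ v τ K R ≤ Mw) :
    ∀ n : ℕ, ∀ P : Site 3, Inv D v τ K k N R P → pot v R Acap P < (n + 1) * Acap →
      Datum D Λ p' Mw ((α₂ * A.α) ^ n) (n * k) P (tgt v R) := by
  have hq1 : α₂ * A.α ≤ 1 := by
    have h1 : α₂ ≤ 1 := (harm 0 (zero_mem_slab 3 k)).trans measureReal_le_one
    have h2 : A.α ≤ 1 := (A.shallow_arm 0 (zero_mem_slab 3 k)).trans measureReal_le_one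
    exact mul_le_one₀ h1 A.α_pos.le h2
  have hq0 : 0 ≤ α₂ * A.α := mul_nonneg hα₂.le A.α_pos.le
  intro n
  induction n with
  | zero =>
    intro P hI hpot
    have hM := hI.2.2.2
    have g0 := gapA_props Acap (hM 0); have g1 := gapA_props Acap (hM 1); have g2 := gapA_props Acap (hM 2)
    unfold pot at hpot
    have hpot' : gapA Acap (tgt v R 0) (P 0) + gapA Acap (tgt v R 1) (P 1) + gapA Acap (tgt v R 2) (P 2) < Acap := by
      simpa using hpot
    have hPΩ : P = tgt v R := by
      have a0 := g0.2 (by omega); have a1 := g1.2 (by omega); have a2 := g2.2 (by omega)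
      funext j
      fin_cases j
      · exact a0
      · exact a1
      · exact a2
    rw [hPΩ]
    simpa using datum_refl D Λ p' Mw (tgt v R)
  | succ n ih =>
    intro P hI hpot
    by_cases hPΩ : P = tgt v R
    · rw [hPΩ]
      exact datum_weaken (pow_le_one₀ hq0 hq1) (Nat.zero_le _) le_rfl (datum_refl D Λ p' Mw (tgt v R))
    · have hM := hI.2.2.2
      obtain ⟨π, hlo, hmh, hlt⟩ := exists_frame hκ hvκ hM hPΩ
      -- the move size `a = min(A, gap)`
      set a : ℕ := min Acap (tgt v R (π 1) - P (π 1)).toNat with ha_def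
      have hgap : ((tgt v R (π 1) - P (π 1)).toNat : ℤ) = tgt v R (π 1) - P (π 1) := Int.toNat_of_nonneg (by omega)
      have haA : a ≤ Acap := min_le_left _ _
      have hag : (a : ℤ) ≤ tgt v R (π 1) - P (π 1) := by
        have : a ≤ (tgt v R (π 1) - P (π 1)).toNat := min_le_right _ _
        have : (a : ℤ) ≤ ((tgt v R (π 1) - P (π 1)).toNat : ℤ) := by exact_mod_cast this
        omega
      have ha1 : 1 ≤ a := by
        rw [ha_def, le_min_iff]; refine ⟨hA1, ?_⟩
        have : (1 : ℤ) ≤ ((tgt v R (π 1) - P (π 1)).toNat : ℤ) := by omega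
        exact_mod_cast this
      have hfull : a = Acap ∨ P (π 1) + a = tgt v R (π 1) := by
        by_cases h : Acap ≤ (tgt v R (π 1) - P (π 1)).toNat
        · exact Or.inl (by rw [ha_def, min_eq_left h])
        · right
          have : a = (tgt v R (π 1) - P (π 1)).toNat := by rw [ha_def, min_eq_right (by omega)]
          have : (a : ℤ) = tgt v R (π 1) - P (π 1) := by rw [this]; exact hgap
          omega
      obtain ⟨hd, hI'⟩ := move_step hκ hvκ hvK hτ hh hCD hΛ A hm hmK hα₂ harm hR0 hcapS hcapT hMw hI π hlo hmh haA (by omega)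
      set P' := P + (a : ℤ) • (Pi.single (π 1) 1 : Site 3) with hP'
      -- the potential drops by `≥ A`
      have hco : ∀ j, P' j = P j + if j = π 1 then (a : ℤ) else 0 := fun j => raise_apply P (π 1) a j
      have hmove := gapA_move Acap (T := tgt v R (π 1)) (P := P (π 1)) ha1 (by omega) hfull
      have hpot' : pot v R Acap P' < (n + 1) * Acap := by
        have e : ∀ j, j ≠ π 1 → gapA Acap (tgt v R j) (P' j) = gapA Acap (tgt v R j) (P j) := fun j hj => by
          rw [hco j, if_neg hj, add_zero]
        have e1 : gapA Acap (tgt v R (π 1)) (P' (π 1)) + Acap ≤ gapA Acap (tgt v R (π 1)) (P (π 1)) := by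
          rw [hco (π 1), if_pos rfl]; exact hmove
        unfold pot at hpot ⊢
        push_cast at hpot ⊢
        generalize hl : π 1 = l at e e1
        fin_cases l
        · have := e 1 (by decide); have := e 2 (by decide); simp only [Fin.zero_eta, Fin.isValue] at e1; linarith
        · have := e 0 (by decide); have := e 2 (by decide); simp only [Fin.mk_one, Fin.isValue] at e1; linarith
        · have := e 0 (by decide); have := e 1 (by decide); simp only [Fin.reduceFinMk, Fin.isValue] at e1; linarith
      have h₂ := ih P' hI' hpot'
      have h := datum_chain hq0 hd h₂
      rw [← pow_succ', show k + n * k = (n + 1) * k by ring] at h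
      exact h

end Cone

end WCone

end Summit.CriticalPhenomena.PercolationContinuityZ3.Theorems.Transplant

end
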